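import Summits.Ventures.PercRepro2.CaseOneJOneStar
import Summits.Ventures.PercRepro2.CaseOneStarPendant

/-!
# `(J1)` for `a₃` pendant at a marked-star vertex (blind cell PercRepro2, p1 g19; row 2′J1)

`IsPendantStarAt.swap` and the mirror of `jOneOne_of_leaf_markedStar` / `jOneOne_of_pendantStar`
(CaseOneStarPendant) give **`jOne_of_leaf_markedStar`**, **`jOne_of_pendantStar`**. Own code;
standard axioms.
-/

namespace Summit.Ventures.PercRepro2

namespace CaseOne

section Swap
variable {V : Type*} {E : Type*}
variable {ends : E → Sym2 V} {o a₁ a₂ b u a₃ : V} {e₀ e₁ e₂ eo eb : E}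

/-- The pendant star with the roots swapped. -/
theorem IsPendantStarAt.swap (h : IsPendantStarAt ends o a₁ a₂ b u a₃ e₀ e₁ e₂ eo eb) :
    IsPendantStarAt ends o a₂ a₁ b u a₃ e₀ e₂ e₁ eo eb where
  leaf := h.leaf
  ends_1 := h.ends_2
  ends_2 := h.ends_1
  ends_o := h.ends_o
  ends_b := h.ends_b
  ne_12 := h.ne_12.symm
  ne_1o := h.ne_2o
  ne_1b := h.ne_2b
  ne_2o := h.ne_1o
  ne_2b := h.ne_1b
  ne_ob := h.ne_ob
  unique := fun e he => by
    rcases h.unique e he with h' | h' | h' | h' | h'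
    · exact Or.inl h'
    · exact Or.inr (Or.inr (Or.inl h'))
    · exact Or.inr (Or.inl h')
    · exact Or.inr (Or.inr (Or.inr (Or.inl h')))
    · exact Or.inr (Or.inr (Or.inr (Or.inr h')))
  ne_a1 := h.ne_a2
  ne_a2 := h.ne_a1
  ne_o := h.ne_o
  ne_b := h.ne_b
  ne_a1' := h.ne_a2'
  ne_a2' := h.ne_a1'
  ne_o' := h.ne_o'
  ne_b' := h.ne_b'

end Swap

section JOne
variable {V : Type*} {E : Type*} [Fintype E] [DecidableEq E] [Fintype V] [DecidableEq V]
  {R : Type*} [Field R] [LinearOrder R] [IsStrictOrderedRing R]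
variable {ends : E → Sym2 V} {o a₁ a₂ b u a₃ : V} {e₀ e₁ e₂ eo eb : E}

/-- **`(J1)` for `a₃` pendant at a marked-star vertex** (the `G − e₀` form). -/
theorem jOne_of_leaf_markedStar (p : E → R) (hp : IsProbVec p) (hl : IsLeafAt ends u a₃ e₀)
    (ho : o ≠ a₃) (h1 : a₁ ≠ a₃) (h2 : a₂ ≠ a₃) (hb : b ≠ a₃) {e₁ e₂ eo eb : {e : E // e ≠ e₀}}
    (h : IsMarkedStarAt (restrictEnds ends e₀) o a₁ a₂ b u e₁ e₂ eo eb) :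
    JOne p ends o a₁ a₂ a₃ b :=
  jOne_of_jOneOne_of_mirror p ends o a₁ a₂ a₃ b
    (jOneOne_of_leaf_markedStar p hp hl ho h1 h2 hb h)
    (jOneOne_of_leaf_markedStar p hp hl ho h2 h1 hb h.swap)

/-- **`(J1)` for the pendant star in `G`.** -/
theorem jOne_of_pendantStar (p : E → R) (hp : IsProbVec p)
    (h : IsPendantStarAt ends o a₁ a₂ b u a₃ e₀ e₁ e₂ eo eb) : JOne p ends o a₁ a₂ a₃ b :=
  jOne_of_jOneOne_of_mirror p ends o a₁ a₂ a₃ b (jOneOne_of_pendantStar p hp h)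
    (jOneOne_of_pendantStar p hp h.swap)

end JOne

end CaseOne

end Summit.Ventures.PercRepro2
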